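import Literature.MathematicalPhysics.QuantumFieldTheory.Balaban1983to89.B9Eq349LaplacePrimeBlockLetters
import Literature.MathematicalPhysics.QuantumFieldTheory.Balaban1983to89.B9Eq349BlockDecayAlgebraLocal
import Literature.MathematicalPhysics.QuantumFieldTheory.Balaban1983to89.B9Eq349QGGQPerturbationLetters

/-!
# `Balaban1983to89.B9Eq349DPBlockDecayLetters` — T. Bałaban, *Propagators for lattice gauge theories in a background field*, Commun. Math. Phys.
# **99** (1985) 389–434 [Balaban1985BackgroundPropagators] (3.25)–(3.26) pp. 394–395 with (3.3) p. 391, (3.19) p. 393, (3.49) p. 399 and (3.101)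
# p. 414: **BLOCK DECAY OF `T(U) = D_U(1 − R(U))` BETWEEN THE FINE SITE BLOCKS AND THE FINE BOND BLOCKS, AT A GENERAL BACKGROUND `U`, FROM FOUR
# LETTERS — `T(U) = A(U) ∘ c(U) ∘ B(U)` with `A(U) = D_UG′(U)Q̃′(U)†`, `c(U) = (Q̃′G′(U)²Q̃′†)⁻¹`, `B(U) = Q̃′(U)G′(U)` ((3.25)); `D_U` is LOCAL (range
# `1`, size `M_D`, count `3^d`), `Q̃′(U)`∕`Q̃′(U)†` are block-DIAGONAL (size `M_Q`), so `A`, `B` inherit `G′(U)`'s letter `(C_G, κ)` at the SAME rate, and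
# the three-factor composition through the coarse points gives `(C_A·C_c·C_B·K_d(κ−κ′)², κ′)` — the `hτ` shape of (K3)∕(K4b) §3 at `U ≠ 1` with the
# letters `(C_G, κ)` (supplier (S3c) or `B9Eq349GreenPerturbedBlockDecay` §2) and `(C_c, κ)` (supplier (S3d)) DISPLAYED** — route R2′ STEP B8′, road
# B8″ sub-step S3 of the pub-balaban NE9 chain, instance-ledger row L9 ((S3f): the assembly; lineage HANDOFF § gen 84)

statement-level skeleton of published theorems with citation tags; proofs where landed; nothing here is a claim about the Yang–Mills mass gap

CITATION HEADER (lean-in-tree rule).  Audit cell `pub-balaban`, sub-cell `t4`, BINDER row NE9; filed by NE9 formalisation-swarm LEAF PROVER 01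
(`b2b-balaban-t4-ne9-formalise-leaf-01`, gen 85), composing BY NAME: (S3a) `B9Eq349BlockDecayAlgebra` (`norm_block_comp_le_sum`,
`norm_block_comp3_le_of_decay_torus`), (Local) `B9Eq349BlockDecayAlgebraLocal.sum_local_le`, (S3b) `B9Eq349QGGQPerturbationLetters.decay_comp_diag_left` ∕
`_right`, (S3e-Q) `B9Eq349QtildeBlockLetters` (the `Q`∕`Q♮` letters), (S3e-H) `B9Eq349LaplacePrimeBlockLetters` (one fine step moves `blk` by `≤ 1`; the
count `3^d`), (K1) `B9Eq349BlockMultipliers`, the OWNER lineage's `B9Eq373DerivativeRemainderL2.norm_covDerivL2K_le` (`‖D_U‖ ≤ 2(1+ε_R)‖η⁻¹‖√d`),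
`B9Eq384RemainderLetters.norm_adTransportW_sub_le`, `B9Eq325ProjFormula.RofU_eq_formula` ((3.25): `1 − R(U) = G′Q̃′†(Q̃′G′²Q̃′†)⁻¹Q̃′G′`) ∕ `QGGQ_pos`.
ROUTE LOCUS: `t4/ROUTES-NE9.md` v13.39 §L1.2 ADDENDUM (i) «composed ONCE» ∕ (ii) «the product with the local factor costs NO coarse sum and NO rate»
(t4-ne9-idea-1 g102, credited); lineage HANDOFF § gen 84 «(S3f) A(U), B(U) … T(U) = A∘c∘B by (S3a) comp3».  Source READ in the held text
[Balaban1985BackgroundPropagators]: p. 391 (3.3), p. 393 (3.19), p. 394 (3.21) *«R — the orthogonal projection onto Δ^η_U N(Q′)»*, (3.25) *«R = G′Q′*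
(Q′G′²Q′*)⁻¹Q′G′Δ′_a»* (our `RofU_eq_formula`), p. 395 (3.26), p. 399 (3.49), p. 414 (3.101) *«R(□) … small factor O(M⁻¹) … together with the
exponential decay»*; [Balaban1984PropagatorsI] p. 38 for the three-factor shape.  NOTHING of print's estimates is asserted.

WHAT IS PROVED (sorry-free; proof lane — no `def`; [folklore] finite sums and compositions BY NAME).
* §1 **`norm_block_comp_le_of_local_left`** (abstract, any pseudo-metric with triangle + symmetry): `D` of block range `ρ` and size `M_D` after `A` with
  `(C, κ)` ⟹ `D ∘ A` with `(M_D·N_ρ·e^{κρ}·C, κ)` — same rate, only the count letter paid.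
* §2 **`bondBlock_comp_covDeriv_comp_block_eq_zero`** (`P^B_{y₁} ∘ D_{c,R} ∘ P_{y₀} = 0` for `d_m(y₀,y₁) > 1`, ANY `c, R`; bond blocks by `blk b₋`),
  `norm_bondBlock_comp_comp_block_le_opNorm`, **`norm_bondBlock_comp_covDeriv_comp_block_le`** (`≤ M_D = 2(1+ε_R)‖η⁻¹‖√d`, `ε_R = 2M_φM_φ′ε_U`).
* §3 **`norm_point_comp_QG_comp_block_le`** (`B(U)`: `(M_Q·C_G, κ)`, `M_Q = P√(c₁∕(c₀L^d))`), **`norm_block_comp_GQadj_comp_point_le`** (`G′Q̃′†`: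
  `(C_G·M_Q, κ)`), **`norm_bondBlock_comp_DGQadj_comp_point_le`** (`A(U)`: `(M_D·3^d·e^{κ}·C_G·M_Q, κ)`), **`DP_eq_comp3`** (`D_U ∘ (1 − R(U)) = A ∘ c ∘ B`
  as CLMs, `c = greenK` at ANY positivity witness), **`norm_bondBlock_comp_DP_comp_block_le`**: for `0 ≤ κ′ < κ`, given `(C_G, κ)` for `G′(U)` on the
  fine blocks and `(C_c, κ)` for `c(U)` on the coarse points, `‖P^B_{y₁} ∘ D_U(1 − R(U)) ∘ P_{y₀}‖ ≤ C_A·C_c·C_B·K_d(κ−κ′)²·e^{−κ′d_m(y₀,y₁)}`;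
  the SITES → SITES twin `oneSubR_eq_comp3` ∕ **`norm_block_comp_oneSubR_comp_block_le`** (`P(U) = 1 − R(U)`: `(C_GM_Q)·C_c·(M_QC_G)·K_d(κ−κ′)²` at `κ′` —
  the `hdec` shape of ne9-leaf-05's (K6T)∕(K6P) at `U ≠ 1`).
HONEST SCOPE.  Composition; `M_D`, `M_Q`, `3^d`, `K_d` are letters, `C_G`, `C_c`, `κ` DISPLAYED inputs (their windows live with their suppliers); no number
evaluated; the `∃ (C_τ, r)`-first packaging over the window `‖U − 1‖ ≤ ε_U` (row L9 at `U ≠ 1` into (K4b) §3∕§4) is the sequel.  ONE instance (S3f) of ONE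
sub-step, NOT NE9 (cell pub-balaban: NE9 NOT PRINTED ∕ NOT PROVED; «NE9 ⇐ the named binders»; row WALLED ON A MODEL (O-NE9-1; #5 UNRULED); spine
PROVED 0∕9; rung (B)+1 on a finite T⁴ — NOT infinite volume, NOT mass gap, NOT Clay; HONEST DEPENDENCY: continuum YM on T⁴ ⇐ BetaPertH ∧ nine spine
estimates (0/9 proved); BetaPertH ⇐ (D1) ∧ (D4) ∧ CAP+tail; G-an2-4 gates asym, D1 and NE2/3/4).  NEW file importing (S3e-H), (Local), (S3b); nothing
modified.  Net new unproved facts: 0.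
-/

noncomputable section

set_option autoImplicit false

open scoped InnerProductSpace ComplexConjugate BigOperators

namespace Literature.MathematicalPhysics.QuantumFieldTheory.Balaban1983to89.B9Eq349DPBlockDecayLetters

open ContinuousLinearMap (comp_apply)
open B4Sect5Torus (TSite tdist tdist_nonneg tdist_triangle tdist_symm tdist_self torusSum_le)
open B4Sect5Proof (latticeConst latticeConst_nonneg)
open B9SectCLatticeCarrier (Bond bpos btgt shift)
open B9Eq311L2Pairing (WL2)
open B9Eq319QprimeTorus (fineP blockCoord)
open B11Eq103H1Complex (SiteL2K BondL2K covDerivL2K equiv_covDerivL2K greenK)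
open B7Prop1Explicit (U1)
open B9Eq310HessianOperator (adTransportW)
open B9Eq326OperatorAssembly (QprimeW RofU)
open B9Eq3119DeltaPiCarrier (laplacePrimeA GpOfU)
open B9Eq325ProjFormula (RofU_eq_formula QGGQ_pos)
open B9Eq33CovDerivVector (covDeriv_apply)
open B9Eq349BlockMultipliers (opNorm_block_le sum_block_apply block_comp_self)
open B9Eq349QtildeBlockLetters (point_comp_Qtilde_comp_block_eq_zero block_comp_adjoint_Qtilde_comp_point_eq_zero
  norm_point_comp_Qtilde_comp_block_le norm_block_comp_adjoint_comp_point_le)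
open B9Eq373DerivativeRemainderL2 (norm_covDerivL2K_le)
open B9Eq384RemainderLetters (norm_adTransportW_sub_le)
open B9Eq349BlockDecayAlgebra (norm_block_comp_le_sum norm_block_comp3_le_of_decay_torus)
open B9Eq349BlockDecayAlgebraLocal (sum_local_le)
open B9Eq349QGGQPerturbationLetters (decay_comp_diag_left decay_comp_diag_right)
open B9Eq349LaplacePrimeBlockLetters (tdist_blockCoord_shift_le_one card_tdist_le_one_le)

/-! ## §1 A LOCAL left factor costs the count letter only (no coarse sum, no rate) -/

section Local

variable {𝕜 : Type*} [NontriviallyNormedField 𝕜] {S V E : Type*} [NormedAddCommGroup S] [NormedSpace 𝕜 S] [NormedAddCommGroup V]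
  [NormedSpace 𝕜 V] [NormedAddCommGroup E] [NormedSpace 𝕜 E] {ι : Type*} [Fintype ι]
  {δ : ι → ι → ℝ} (hδt : ∀ x y z, δ x z ≤ δ x y + δ y z) (hδs : ∀ y z, δ y z = δ z y)

include hδt hδs in
/-- **A LOCAL LEFT FACTOR**: `D : V → E` with block range `ρ` (`q_{y₁} ∘ D ∘ r_z = 0` for `δ(z,y₁) > ρ`, `≤ M_D` within) after `A` with block decay
`(C, κ)` gives `D ∘ A` the decay `(M_D·N_ρ·e^{κρ}·C, κ)` — SAME rate, NO coarse sum: only the count letter `#{z : δ(y,z) ≤ ρ} ≤ N_ρ` is paid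
((Local) `sum_local_le`; t4-ne9-idea-1 g102's located word (ii), credited). [folklore] [cite: Balaban1985BackgroundPropagators, p.415, (3.49) p.399] -/
theorem norm_block_comp_le_of_local_left (r : ι → V →L[𝕜] V) (hsum : ∀ v, ∑ z, r z v = v) (hidem : ∀ z, r z ∘L r z = r z)
    (D : V →L[𝕜] E) (A : S →L[𝕜] V) (q : ι → E →L[𝕜] E) (p : ι → S →L[𝕜] S) {MD C κ ρ : ℝ} {Nρ : ℕ} (hMD : 0 ≤ MD) (hC : 0 ≤ C)
    (hκ : 0 ≤ κ) (hfar : ∀ z y₁, ρ < δ z y₁ → q y₁ ∘L D ∘L r z = 0) (hnear : ∀ z y₁, ‖q y₁ ∘L D ∘L r z‖ ≤ MD)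
    (hN : ∀ y, (Finset.univ.filter fun z => δ y z ≤ ρ).card ≤ Nρ)
    (hA : ∀ y₀ z, ‖r z ∘L A ∘L p y₀‖ ≤ C * Real.exp (-(κ * δ y₀ z))) (y₀ y₁ : ι) :
    ‖q y₁ ∘L (D ∘L A) ∘L p y₀‖ ≤ MD * Nρ * Real.exp (κ * ρ) * C * Real.exp (-(κ * δ y₀ y₁)) := by
  classical
  refine (norm_block_comp_le_sum r hsum hidem D A (q y₁) (p y₀)).trans ?_
  have hsplit : ∑ z, ‖q y₁ ∘L D ∘L r z‖ * ‖r z ∘L A ∘L p y₀‖ =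
      ∑ z ∈ Finset.univ.filter (fun z => δ y₁ z ≤ ρ), ‖q y₁ ∘L D ∘L r z‖ * ‖r z ∘L A ∘L p y₀‖ := by
    rw [Finset.sum_filter]
    refine Finset.sum_congr rfl fun z _ => ?_
    by_cases hz : δ y₁ z ≤ ρ
    · rw [if_pos hz]
    · rw [if_neg hz, hfar z y₁ (by rw [hδs]; exact lt_of_not_ge hz), norm_zero, zero_mul]
  rw [hsplit]
  calc ∑ z ∈ Finset.univ.filter (fun z => δ y₁ z ≤ ρ), ‖q y₁ ∘L D ∘L r z‖ * ‖r z ∘L A ∘L p y₀‖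
      ≤ ∑ z ∈ Finset.univ.filter (fun z => δ y₁ z ≤ ρ), MD * (C * Real.exp (-(κ * δ z y₀))) :=
        Finset.sum_le_sum fun z _ => by
          rw [hδs z y₀]
          exact mul_le_mul (hnear z y₁) (hA y₀ z) (norm_nonneg _) hMD
    _ = MD * C * ∑ z ∈ Finset.univ.filter (fun z => δ y₁ z ≤ ρ), Real.exp (-(κ * δ z y₀)) := by
        rw [Finset.mul_sum]; exact Finset.sum_congr rfl fun z _ => by ring
    _ ≤ MD * C * (Nρ * Real.exp (κ * ρ) * Real.exp (-(κ * δ y₁ y₀))) :=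
        mul_le_mul_of_nonneg_left (sum_local_le hδt hκ hN y₁ y₀) (mul_nonneg hMD hC)
    _ = MD * Nρ * Real.exp (κ * ρ) * C * Real.exp (-(κ * δ y₀ y₁)) := by rw [hδs y₁ y₀]; ring

end Local

/-! ## §2 The covariant derivative `D_U` between the fine site blocks and the fine bond blocks: range one, size `M_D` -/

section Deriv

variable {d : ℕ} {L : ℕ} [NeZero L] {m : Fin d → ℕ}
  {W : Type*} [NormedAddCommGroup W] [InnerProductSpace ℂ W] [FiniteDimensional ℂ W] {c₀ : ℝ} [Fact (0 < c₀)]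
  {PS : TSite d m → SiteL2K ℂ d (fineP L m) c₀ W →L[ℂ] SiteL2K ℂ d (fineP L m) c₀ W}
  (hPS : ∀ (y : TSite d m) (f : SiteL2K ℂ d (fineP L m) c₀ W) (x : TSite d (fineP L m)),
    WL2.equiv ℂ (fun _ : TSite d (fineP L m) => c₀) W (PS y f) x =
      if blockCoord L m x = y then WL2.equiv ℂ (fun _ : TSite d (fineP L m) => c₀) W f x else 0)
  {PB : TSite d m → BondL2K ℂ d (fineP L m) c₀ W →L[ℂ] BondL2K ℂ d (fineP L m) c₀ W}
  (hPB : ∀ (y : TSite d m) (g : BondL2K ℂ d (fineP L m) c₀ W) (b : Bond d (fineP L m)),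
    WL2.equiv ℂ (fun _ : Bond d (fineP L m) => c₀) W (PB y g) b =
      if blockCoord L m (bpos b) = y then WL2.equiv ℂ (fun _ : Bond d (fineP L m) => c₀) W g b else 0)

include hPS hPB in
/-- **`D_U` HAS BLOCK RANGE ONE**: `P^B_{y₁} ∘ D_{c,R} ∘ P_{y₀} = 0` for `d_m(y₀,y₁) > 1`, ANY scalar `c` and transporter `R` — `(D_Rf)(b)` reads `f(b₋)`,
`f(b₊)` ((3.3)), `blk b₊` within `1` of `blk b₋`. [cite: Balaban1985BackgroundPropagators, (3.3) p.391, (3.49) p.399] -/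
theorem bondBlock_comp_covDeriv_comp_block_eq_zero (hm : ∀ i, 1 ≤ m i) (c : ℂ) (R : Bond d (fineP L m) → W →ₗ[ℂ] W) {y₀ y₁ : TSite d m}
    (h : 1 < tdist m y₀ y₁) : PB y₁ ∘L LinearMap.toContinuousLinearMap (covDerivL2K ℂ c₀ c R) ∘L PS y₀ = 0 := by
  refine ContinuousLinearMap.ext fun f => ?_
  apply (WL2.equiv ℂ (fun _ : Bond d (fineP L m) => c₀) W).injective
  funext b
  rw [comp_apply, comp_apply, hPB, zero_apply, WL2.equiv_zero, Pi.zero_apply]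
  by_cases hb : blockCoord L m (bpos b) = y₁
  · rw [if_pos hb]
    have hfar : ∀ z : TSite d (fineP L m), tdist m (blockCoord L m (bpos b)) (blockCoord L m z) ≤ 1 →
        WL2.equiv ℂ (fun _ : TSite d (fineP L m) => c₀) W (PS y₀ f) z = 0 := fun z hz => by
      rw [hPS, if_neg]
      intro hz0
      rw [hz0, hb, tdist_symm hm] at hz
      linarith
    rw [LinearMap.coe_toContinuousLinearMap', equiv_covDerivL2K, covDeriv_apply]
    simp only [bpos, btgt] at hfar ⊢
    rw [hfar b.1 (by rw [tdist_self]; exact zero_le_one), hfar (shift b.2 b.1) (tdist_blockCoord_shift_le_one hm b.1 b.2)]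
    simp
  · rw [if_neg hb]

omit [NeZero L] [FiniteDimensional ℂ W] in
include hPS hPB in
/-- `‖P^B_{y₁} ∘ T ∘ P_{y₀}‖ ≤ ‖T‖` for any `T` from the sites to the bonds (both families contract). [folklore] [cite: Balaban1985BackgroundPropagators, (3.49) p.399] -/
theorem norm_bondBlock_comp_comp_block_le_opNorm (T : SiteL2K ℂ d (fineP L m) c₀ W →L[ℂ] BondL2K ℂ d (fineP L m) c₀ W) (y₀ y₁ : TSite d m) :
    ‖PB y₁ ∘L T ∘L PS y₀‖ ≤ ‖T‖ :=
  calc ‖PB y₁ ∘L T ∘L PS y₀‖ ≤ ‖PB y₁‖ * (‖T‖ * ‖PS y₀‖) :=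
        (ContinuousLinearMap.opNorm_comp_le _ _).trans (mul_le_mul_of_nonneg_left (ContinuousLinearMap.opNorm_comp_le _ _) (norm_nonneg _))
    _ ≤ 1 * (‖T‖ * 1) :=
        mul_le_mul (opNorm_block_le hPB y₁) (mul_le_mul_of_nonneg_left (opNorm_block_le hPS y₀) (norm_nonneg T)) (by positivity) zero_le_one
    _ = ‖T‖ := by ring

variable {𝔸 : Type*} [NormedRing 𝔸] [NormedAlgebra ℂ 𝔸] [NormOneClass 𝔸] {φ : W ≃ₗ[ℂ] 𝔸} {Mφ Mφ' : ℝ}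
  (hφ : ∀ w, ‖φ w‖ ≤ Mφ * ‖w‖) (hφ' : ∀ X, ‖φ.symm X‖ ≤ Mφ' * ‖X‖) (hMφ : 0 ≤ Mφ) (hMφ' : 0 ≤ Mφ')
  {U : Bond d (fineP L m) → 𝔸ˣ} (hU : ∀ b, U b ∈ U1 𝔸) {εU : ℝ} (hεU : 0 ≤ εU) (hUε : ∀ b, ‖(U b : 𝔸) - 1‖ ≤ εU) {η : ℝ}

omit [NeZero L] in
include hPS hPB hφ hφ' hMφ hMφ' hU hεU hUε in
/-- **THE SIZE LETTER `M_D`**: `‖P^B_{y₁} ∘ D_U ∘ P_{y₀}‖ ≤ M_D := 2(1 + ε_R)·‖η⁻¹‖·√d`, `ε_R = 2M_φM_φ′ε_U` (the OWNER lineage's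
`B9Eq373DerivativeRemainderL2.norm_covDerivL2K_le` with the transporter letter `norm_adTransportW_sub_le`). [cite: Balaban1985BackgroundPropagators, (3.3) p.391, (3.35) p.396] -/
theorem norm_bondBlock_comp_covDeriv_comp_block_le (y₀ y₁ : TSite d m) :
    ‖PB y₁ ∘L LinearMap.toContinuousLinearMap (covDerivL2K ℂ c₀ ((η : ℂ))⁻¹ (adTransportW φ U)) ∘L PS y₀‖ ≤
      2 * (1 + 2 * Mφ * Mφ' * εU) * ‖((η : ℂ))⁻¹‖ * Real.sqrt d := by
  have hεR : 0 ≤ 2 * Mφ * Mφ' * εU := by positivity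
  have hR : ∀ (b : Bond d (fineP L m)) (w : W), ‖adTransportW φ U b w - w‖ ≤ 2 * Mφ * Mφ' * εU * ‖w‖ := fun b w =>
    norm_adTransportW_sub_le φ hφ hφ' hMφ' U b (hU b) (hUε b) w
  refine (norm_bondBlock_comp_comp_block_le_opNorm hPS hPB _ y₀ y₁).trans (ContinuousLinearMap.opNorm_le_bound _ (by positivity) fun f => ?_)
  rw [LinearMap.coe_toContinuousLinearMap']
  exact norm_covDerivL2K_le _ hεR hR f

end Deriv

/-! ## §3 The three factors of `T(U) = D_U(1 − R(U)) = A(U) ∘ c(U) ∘ B(U)` and their composition -/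

section Assembly

variable {d : ℕ} {L : ℕ} [NeZero L] {m : Fin d → ℕ} {𝔸 : Type*} [NormedRing 𝔸] [NormedAlgebra ℂ 𝔸] [NormOneClass 𝔸]
  {W : Type*} [NormedAddCommGroup W] [InnerProductSpace ℂ W] [FiniteDimensional ℂ W] {φ : W ≃ₗ[ℂ] 𝔸}
  {c₀ : ℝ} [Fact (0 < c₀)] {c₁ : ℝ} [Fact (0 < c₁)] {η : ℝ} {a' : ℝ}
  {PS : TSite d m → SiteL2K ℂ d (fineP L m) c₀ W →L[ℂ] SiteL2K ℂ d (fineP L m) c₀ W}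
  (hPS : ∀ (y : TSite d m) (f : SiteL2K ℂ d (fineP L m) c₀ W) (x : TSite d (fineP L m)),
    WL2.equiv ℂ (fun _ : TSite d (fineP L m) => c₀) W (PS y f) x =
      if blockCoord L m x = y then WL2.equiv ℂ (fun _ : TSite d (fineP L m) => c₀) W f x else 0)
  {PB : TSite d m → BondL2K ℂ d (fineP L m) c₀ W →L[ℂ] BondL2K ℂ d (fineP L m) c₀ W}
  (hPB : ∀ (y : TSite d m) (g : BondL2K ℂ d (fineP L m) c₀ W) (b : Bond d (fineP L m)),
    WL2.equiv ℂ (fun _ : Bond d (fineP L m) => c₀) W (PB y g) b =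
      if blockCoord L m (bpos b) = y then WL2.equiv ℂ (fun _ : Bond d (fineP L m) => c₀) W g b else 0)
  {r : TSite d m → SiteL2K ℂ d m c₁ W →L[ℂ] SiteL2K ℂ d m c₁ W}
  (hr : ∀ (y : TSite d m) (g : SiteL2K ℂ d m c₁ W) (z : TSite d m),
    WL2.equiv ℂ (fun _ : TSite d m => c₁) W (r y g) z = if z = y then WL2.equiv ℂ (fun _ : TSite d m => c₁) W g z else 0)
  {Mφ Mφ' : ℝ} (hφ : ∀ w, ‖φ w‖ ≤ Mφ * ‖w‖) (hφ' : ∀ X, ‖φ.symm X‖ ≤ Mφ' * ‖X‖) (hMφ : 0 ≤ Mφ) (hMφ' : 0 ≤ Mφ')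
  {U : Bond d (fineP L m) → 𝔸ˣ} (hU : ∀ b, U b ∈ U1 𝔸) {εU : ℝ} (hεU : 0 ≤ εU) (hUε : ∀ b, ‖(U b : 𝔸) - 1‖ ≤ εU)
  (hRS : ∀ (b : Bond d (fineP L m)) (v u : W), ⟪adTransportW φ U b v, u⟫_ℂ = ⟪v, adTransportW φ (fun b => (U b)⁻¹) b u⟫_ℂ)
  (hposU : ∀ x : SiteL2K ℂ d (fineP L m) c₀ W, x ≠ 0 → 0 < RCLike.re ⟪x, laplacePrimeA L m φ η U a' (c₁ := c₁) x⟫_ℂ)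

include hPS hr hφ hφ' hMφ hMφ' hU hεU hUε in
/-- **THE FACTOR `B(U) = Q̃′(U)G′(U)`** (fine sites → coarse points): a block-DIAGONAL left factor after `G′(U)` — `(M_Q·C_G, κ)` with `M_Q = P√(c₁∕(c₀L^d))`
((S3b) `decay_comp_diag_left` with (S3e-Q)'s `Q`-letters), given `G′(U)`'s letter `(C_G, κ)` on the fine blocks. [cite: Balaban1985BackgroundPropagators, (3.19) p.393, (3.25) p.394, (3.49) p.399] -/
theorem norm_point_comp_QG_comp_block_le {CG κ : ℝ}
    (hGd : ∀ y₀ y₁, ‖PS y₁ ∘L LinearMap.toContinuousLinearMap (GpOfU L m φ η U a' (c₁ := c₁) hposU) ∘L PS y₀‖ ≤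
      CG * Real.exp (-(κ * tdist m y₀ y₁))) (y₀ z : TSite d m) :
    ‖r z ∘L (LinearMap.toContinuousLinearMap ((WL2.linearEquiv ℂ ℂ (fun _ : TSite d m => c₁)).symm.toLinearMap ∘ₗ QprimeW L m φ U (c₀ := c₀)) ∘L
        LinearMap.toContinuousLinearMap (GpOfU L m φ η U a' (c₁ := c₁) hposU)) ∘L PS y₀‖ ≤
      (1 + 2 * Mφ * Mφ' * εU) ^ (d * (L - 1)) * Real.sqrt (c₁ / (c₀ * (L : ℝ) ^ d)) * CG * Real.exp (-(κ * tdist m y₀ z)) :=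
  decay_comp_diag_left (δ := tdist m) PS (sum_block_apply hPS) (block_comp_self hPS) _ _ r PS
    (fun z' y hz => point_comp_Qtilde_comp_block_eq_zero hr hPS U (Ne.symm hz)) (by positivity)
    (fun y => norm_point_comp_Qtilde_comp_block_le hr hPS hφ hφ' hMφ hMφ' hU hεU hUε y y) hGd y₀ z

include hPS hr hφ hφ' hMφ hMφ' hU hεU hUε in
/-- **THE FACTOR `G′(U)Q̃′(U)†`** (coarse points → fine sites): a block-DIAGONAL right factor before `G′(U)` — `(C_G·M_Q, κ)` ((S3b) `decay_comp_diag_right`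
with (S3e-Q)'s transposed letters). [cite: Balaban1985BackgroundPropagators, (3.19) p.393, (3.25)–(3.26) pp.394–395, (3.49) p.399] -/
theorem norm_block_comp_GQadj_comp_point_le {CG κ : ℝ}
    (hGd : ∀ y₀ y₁, ‖PS y₁ ∘L LinearMap.toContinuousLinearMap (GpOfU L m φ η U a' (c₁ := c₁) hposU) ∘L PS y₀‖ ≤
      CG * Real.exp (-(κ * tdist m y₀ y₁))) (z y₁ : TSite d m) :
    ‖PS y₁ ∘L (LinearMap.toContinuousLinearMap (GpOfU L m φ η U a' (c₁ := c₁) hposU) ∘L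
        ContinuousLinearMap.adjoint (LinearMap.toContinuousLinearMap
          ((WL2.linearEquiv ℂ ℂ (fun _ : TSite d m => c₁)).symm.toLinearMap ∘ₗ QprimeW L m φ U (c₀ := c₀)))) ∘L r z‖ ≤
      CG * ((1 + 2 * Mφ * Mφ' * εU) ^ (d * (L - 1)) * Real.sqrt (c₁ / (c₀ * (L : ℝ) ^ d))) * Real.exp (-(κ * tdist m z y₁)) :=
  decay_comp_diag_right (δ := tdist m) PS (sum_block_apply hPS) (block_comp_self hPS) _ _ PS r
    (fun y z' hz => block_comp_adjoint_Qtilde_comp_point_eq_zero hr hPS U (Ne.symm hz)) (by positivity)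
    (fun y => norm_block_comp_adjoint_comp_point_le hr hPS _ y y (norm_point_comp_Qtilde_comp_block_le hr hPS hφ hφ' hMφ hMφ' hU hεU hUε y y))
    hGd z y₁

include hPS hPB hr hφ hφ' hMφ hMφ' hU hεU hUε in
/-- **THE FACTOR `A(U) = D_U G′(U)Q̃′(U)†`** (coarse points → fine bonds): the LOCAL left factor `D_U` (range `1`, size `M_D`, count `3^d`; §1–§2) after
`G′(U)Q̃′(U)†` — `(M_D·3^d·e^{κ}·C_G·M_Q, κ)`, same rate. [cite: Balaban1985BackgroundPropagators, (3.3) p.391, (3.25) p.394, (3.49) p.399, p.415] -/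
theorem norm_bondBlock_comp_DGQadj_comp_point_le (hm : ∀ i, 1 ≤ m i) {CG κ : ℝ} (hCG : 0 ≤ CG) (hκ : 0 ≤ κ)
    (hGd : ∀ y₀ y₁, ‖PS y₁ ∘L LinearMap.toContinuousLinearMap (GpOfU L m φ η U a' (c₁ := c₁) hposU) ∘L PS y₀‖ ≤
      CG * Real.exp (-(κ * tdist m y₀ y₁))) (z y₁ : TSite d m) :
    ‖PB y₁ ∘L (LinearMap.toContinuousLinearMap (covDerivL2K ℂ c₀ ((η : ℂ))⁻¹ (adTransportW φ U)) ∘L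
        (LinearMap.toContinuousLinearMap (GpOfU L m φ η U a' (c₁ := c₁) hposU) ∘L
          ContinuousLinearMap.adjoint (LinearMap.toContinuousLinearMap
            ((WL2.linearEquiv ℂ ℂ (fun _ : TSite d m => c₁)).symm.toLinearMap ∘ₗ QprimeW L m φ U (c₀ := c₀))))) ∘L r z‖ ≤
      2 * (1 + 2 * Mφ * Mφ' * εU) * ‖((η : ℂ))⁻¹‖ * Real.sqrt d * ((3 ^ d : ℕ) : ℝ) * Real.exp (κ * 1) *
        (CG * ((1 + 2 * Mφ * Mφ' * εU) ^ (d * (L - 1)) * Real.sqrt (c₁ / (c₀ * (L : ℝ) ^ d)))) * Real.exp (-(κ * tdist m z y₁)) :=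
  norm_block_comp_le_of_local_left (δ := tdist m) (tdist_triangle hm) (tdist_symm hm) PS (sum_block_apply hPS) (block_comp_self hPS) _ _ PB r
    (by positivity) (by positivity) hκ (fun z' y hz => bondBlock_comp_covDeriv_comp_block_eq_zero hPS hPB hm _ _ hz)
    (fun z' y => norm_bondBlock_comp_covDeriv_comp_block_le hPS hPB hφ hφ' hMφ hMφ' hU hεU hUε z' y) (card_tdist_le_one_le hm)
    (norm_block_comp_GQadj_comp_point_le hPS hr hφ hφ' hMφ hMφ' hU hεU hUε hposU hGd) z y₁

omit [NormOneClass 𝔸] in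
include hRS in
/-- **`T(U) = D_U(1 − R(U)) = A(U) ∘ c(U) ∘ B(U)` AS MAPS** (`c(U) = (Q̃′G′(U)²Q̃′†)⁻¹` by `greenK` at ANY positivity witness — proof-irrelevant):
(3.25)'s `RofU_eq_formula`. [cite: Balaban1985BackgroundPropagators, (3.21) p.394, (3.25) p.394] -/
theorem DP_eq_comp3
    (hXU : ∀ ψ : SiteL2K ℂ d m c₁ W, ψ ≠ 0 → 0 < RCLike.re ⟪ψ, (((WL2.linearEquiv ℂ ℂ (fun _ : TSite d m => c₁)).symm.toLinearMap ∘ₗ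
          QprimeW L m φ U (c₀ := c₀)) ∘ₗ GpOfU L m φ η U a' (c₁ := c₁) hposU ∘ₗ GpOfU L m φ η U a' (c₁ := c₁) hposU ∘ₗ
        LinearMap.adjoint ((WL2.linearEquiv ℂ ℂ (fun _ : TSite d m => c₁)).symm.toLinearMap ∘ₗ QprimeW L m φ U (c₀ := c₀))) ψ⟫_ℂ) :
    LinearMap.toContinuousLinearMap (covDerivL2K ℂ c₀ ((η : ℂ))⁻¹ (adTransportW φ U) ∘ₗ (LinearMap.id - RofU L m φ η U (c₀ := c₀))) =
      (LinearMap.toContinuousLinearMap (covDerivL2K ℂ c₀ ((η : ℂ))⁻¹ (adTransportW φ U)) ∘L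
        (LinearMap.toContinuousLinearMap (GpOfU L m φ η U a' (c₁ := c₁) hposU) ∘L
          ContinuousLinearMap.adjoint (LinearMap.toContinuousLinearMap
            ((WL2.linearEquiv ℂ ℂ (fun _ : TSite d m => c₁)).symm.toLinearMap ∘ₗ QprimeW L m φ U (c₀ := c₀))))) ∘L
      LinearMap.toContinuousLinearMap (greenK _ hXU) ∘L
      (LinearMap.toContinuousLinearMap ((WL2.linearEquiv ℂ ℂ (fun _ : TSite d m => c₁)).symm.toLinearMap ∘ₗ QprimeW L m φ U (c₀ := c₀)) ∘L
        LinearMap.toContinuousLinearMap (GpOfU L m φ η U a' (c₁ := c₁) hposU)) := by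
  refine ContinuousLinearMap.ext fun f => ?_
  simp only [comp_apply, LinearMap.coe_toContinuousLinearMap', LinearMap.comp_apply, LinearMap.sub_apply, LinearMap.id_apply]
  rw [RofU_eq_formula L m φ c₀ η U c₁ a' hRS hposU f, sub_sub_cancel]
  rfl

include hPS hPB hr hφ hφ' hMφ hMφ' hU hεU hUε hRS in
/-- **BLOCK DECAY OF `T(U) = D_U(1 − R(U))` FROM THE LETTERS** — `(C_A·C_c·C_B·K_d(κ−κ′)², κ′)` by (S3a) `norm_block_comp3_le_of_decay_torus` through the
coarse point family twice, with `C_B = M_Q·C_G`, `C_A = M_D·3^d·e^{κ}·C_G·M_Q` (this file) and the DISPLAYED letters `(C_G, κ)` of `G′(U)` (supplier: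
(S3c) `exists_block_decay_Gp` or `B9Eq349GreenPerturbedBlockDecay` §2) and `(C_c, κ)` of `c(U) = (Q̃′G′(U)²Q̃′†)⁻¹` (supplier: (S3d)
`norm_point_block_greenK_le_of_window`): for `0 ≤ κ′ < κ`, `‖P^B_{y₁} ∘ T(U) ∘ P_{y₀}‖ ≤ C_A·C_c·C_B·K_d(κ−κ′)²·e^{−κ′d_m(y₀,y₁)}` — the `hτ` shape of
(K3)∕(K4b) §3 at `U ≠ 1`, κ₁-free. [cite: Balaban1985BackgroundPropagators, (3.25)–(3.26) pp.394–395, (3.49) p.399, (3.101) p.414; Balaban1984PropagatorsI, p.38] -/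
theorem norm_bondBlock_comp_DP_comp_block_le (hm : ∀ i, 1 ≤ m i)
    (hXU : ∀ ψ : SiteL2K ℂ d m c₁ W, ψ ≠ 0 → 0 < RCLike.re ⟪ψ, (((WL2.linearEquiv ℂ ℂ (fun _ : TSite d m => c₁)).symm.toLinearMap ∘ₗ
          QprimeW L m φ U (c₀ := c₀)) ∘ₗ GpOfU L m φ η U a' (c₁ := c₁) hposU ∘ₗ GpOfU L m φ η U a' (c₁ := c₁) hposU ∘ₗ
        LinearMap.adjoint ((WL2.linearEquiv ℂ ℂ (fun _ : TSite d m => c₁)).symm.toLinearMap ∘ₗ QprimeW L m φ U (c₀ := c₀))) ψ⟫_ℂ)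
    {CG Cc κ κ' : ℝ} (hCG : 0 ≤ CG) (hCc : 0 ≤ Cc) (hκ' : 0 ≤ κ') (hκκ : κ' < κ)
    (hGd : ∀ y₀ y₁, ‖PS y₁ ∘L LinearMap.toContinuousLinearMap (GpOfU L m φ η U a' (c₁ := c₁) hposU) ∘L PS y₀‖ ≤
      CG * Real.exp (-(κ * tdist m y₀ y₁)))
    (hcd : ∀ z z', ‖r z' ∘L LinearMap.toContinuousLinearMap (greenK _ hXU) ∘L r z‖ ≤ Cc * Real.exp (-(κ * tdist m z z')))
    (y₀ y₁ : TSite d m) :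
    ‖PB y₁ ∘L LinearMap.toContinuousLinearMap (covDerivL2K ℂ c₀ ((η : ℂ))⁻¹ (adTransportW φ U) ∘ₗ
        (LinearMap.id - RofU L m φ η U (c₀ := c₀))) ∘L PS y₀‖ ≤
      (2 * (1 + 2 * Mφ * Mφ' * εU) * ‖((η : ℂ))⁻¹‖ * Real.sqrt d * ((3 ^ d : ℕ) : ℝ) * Real.exp (κ * 1) *
          (CG * ((1 + 2 * Mφ * Mφ' * εU) ^ (d * (L - 1)) * Real.sqrt (c₁ / (c₀ * (L : ℝ) ^ d))))) * Cc *
        ((1 + 2 * Mφ * Mφ' * εU) ^ (d * (L - 1)) * Real.sqrt (c₁ / (c₀ * (L : ℝ) ^ d)) * CG) * latticeConst d (κ - κ') ^ 2 *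
        Real.exp (-(κ' * tdist m y₀ y₁)) := by
  have hκ : 0 ≤ κ := hκ'.trans hκκ.le
  rw [DP_eq_comp3 hRS hposU hXU]
  exact norm_block_comp3_le_of_decay_torus hm r (sum_block_apply hr) (block_comp_self hr) r (sum_block_apply hr) (block_comp_self hr) _ _ _ PB PS
    (by positivity) hCc (by positivity) hκ' hκκ
    (norm_bondBlock_comp_DGQadj_comp_point_le hPS hPB hr hφ hφ' hMφ hMφ' hU hεU hUε hposU hm hCG hκ hGd) hcd
    (norm_point_comp_QG_comp_block_le hPS hr hφ hφ' hMφ hMφ' hU hεU hUε hposU hGd) y₀ y₁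


omit [NormOneClass 𝔸] in
include hRS in
/-- **`1 − R(U) = (G′(U)Q̃′(U)†) ∘ c(U) ∘ (Q̃′(U)G′(U))` AS MAPS ON THE SITES** ((3.25); `c = greenK` at any positivity witness). [cite: Balaban1985BackgroundPropagators, (3.21) p.394, (3.25) p.394] -/
theorem oneSubR_eq_comp3
    (hXU : ∀ ψ : SiteL2K ℂ d m c₁ W, ψ ≠ 0 → 0 < RCLike.re ⟪ψ, (((WL2.linearEquiv ℂ ℂ (fun _ : TSite d m => c₁)).symm.toLinearMap ∘ₗ
          QprimeW L m φ U (c₀ := c₀)) ∘ₗ GpOfU L m φ η U a' (c₁ := c₁) hposU ∘ₗ GpOfU L m φ η U a' (c₁ := c₁) hposU ∘ₗ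
        LinearMap.adjoint ((WL2.linearEquiv ℂ ℂ (fun _ : TSite d m => c₁)).symm.toLinearMap ∘ₗ QprimeW L m φ U (c₀ := c₀))) ψ⟫_ℂ) :
    LinearMap.toContinuousLinearMap (LinearMap.id - RofU L m φ η U (c₀ := c₀)) =
      (LinearMap.toContinuousLinearMap (GpOfU L m φ η U a' (c₁ := c₁) hposU) ∘L
          ContinuousLinearMap.adjoint (LinearMap.toContinuousLinearMap
            ((WL2.linearEquiv ℂ ℂ (fun _ : TSite d m => c₁)).symm.toLinearMap ∘ₗ QprimeW L m φ U (c₀ := c₀)))) ∘L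
      LinearMap.toContinuousLinearMap (greenK _ hXU) ∘L
      (LinearMap.toContinuousLinearMap ((WL2.linearEquiv ℂ ℂ (fun _ : TSite d m => c₁)).symm.toLinearMap ∘ₗ QprimeW L m φ U (c₀ := c₀)) ∘L
        LinearMap.toContinuousLinearMap (GpOfU L m φ η U a' (c₁ := c₁) hposU)) := by
  refine ContinuousLinearMap.ext fun f => ?_
  simp only [comp_apply, LinearMap.coe_toContinuousLinearMap', LinearMap.sub_apply, LinearMap.id_apply]
  rw [RofU_eq_formula L m φ c₀ η U c₁ a' hRS hposU f, sub_sub_cancel]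
  rfl

include hPS hr hφ hφ' hMφ hMφ' hU hεU hUε hRS in
/-- **THE SITES → SITES TWIN: BLOCK DECAY OF `P(U) = 1 − R(U)` FROM THE LETTERS** — `(C_G·M_Q)·C_c·(M_Q·C_G)·K_d(κ−κ′)²` at rate `κ′` (no `D_U` factor;
the `hdec`∕`hτ` shape ne9-leaf-05's (K6S)∕(K6T) consume, at `U ≠ 1`). [cite: Balaban1985BackgroundPropagators, (3.25)–(3.26) pp.394–395, (3.49) p.399; Balaban1984PropagatorsI, p.38] -/
theorem norm_block_comp_oneSubR_comp_block_le (hm : ∀ i, 1 ≤ m i)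
    (hXU : ∀ ψ : SiteL2K ℂ d m c₁ W, ψ ≠ 0 → 0 < RCLike.re ⟪ψ, (((WL2.linearEquiv ℂ ℂ (fun _ : TSite d m => c₁)).symm.toLinearMap ∘ₗ
          QprimeW L m φ U (c₀ := c₀)) ∘ₗ GpOfU L m φ η U a' (c₁ := c₁) hposU ∘ₗ GpOfU L m φ η U a' (c₁ := c₁) hposU ∘ₗ
        LinearMap.adjoint ((WL2.linearEquiv ℂ ℂ (fun _ : TSite d m => c₁)).symm.toLinearMap ∘ₗ QprimeW L m φ U (c₀ := c₀))) ψ⟫_ℂ)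
    {CG Cc κ κ' : ℝ} (hCG : 0 ≤ CG) (hCc : 0 ≤ Cc) (hκ' : 0 ≤ κ') (hκκ : κ' < κ)
    (hGd : ∀ y₀ y₁, ‖PS y₁ ∘L LinearMap.toContinuousLinearMap (GpOfU L m φ η U a' (c₁ := c₁) hposU) ∘L PS y₀‖ ≤
      CG * Real.exp (-(κ * tdist m y₀ y₁)))
    (hcd : ∀ z z', ‖r z' ∘L LinearMap.toContinuousLinearMap (greenK _ hXU) ∘L r z‖ ≤ Cc * Real.exp (-(κ * tdist m z z')))
    (y₀ y₁ : TSite d m) :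
    ‖PS y₁ ∘L LinearMap.toContinuousLinearMap (LinearMap.id - RofU L m φ η U (c₀ := c₀)) ∘L PS y₀‖ ≤
      (CG * ((1 + 2 * Mφ * Mφ' * εU) ^ (d * (L - 1)) * Real.sqrt (c₁ / (c₀ * (L : ℝ) ^ d)))) * Cc *
        ((1 + 2 * Mφ * Mφ' * εU) ^ (d * (L - 1)) * Real.sqrt (c₁ / (c₀ * (L : ℝ) ^ d)) * CG) * latticeConst d (κ - κ') ^ 2 *
        Real.exp (-(κ' * tdist m y₀ y₁)) := by
  rw [oneSubR_eq_comp3 hRS hposU hXU]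
  exact norm_block_comp3_le_of_decay_torus hm r (sum_block_apply hr) (block_comp_self hr) r (sum_block_apply hr) (block_comp_self hr) _ _ _ PS PS
    (by positivity) hCc (by positivity) hκ' hκκ
    (norm_block_comp_GQadj_comp_point_le hPS hr hφ hφ' hMφ hMφ' hU hεU hUε hposU hGd) hcd
    (norm_point_comp_QG_comp_block_le hPS hr hφ hφ' hMφ hMφ' hU hεU hUε hposU hGd) y₀ y₁

end Assembly

end Literature.MathematicalPhysics.QuantumFieldTheory.Balaban1983to89.B9Eq349DPBlockDecayLetters

end
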